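import Summits.CriticalPhenomena.CardyFormulaZ2.Theorems.CardyIKTransportCornerLineDescentOfInfluenceBounds
import Summits.CriticalPhenomena.CardyFormulaZ2.Theses.CardyDiluteOrbit
import Literature.Probability.RandomPlanarGeometry.LatticeSimilarityCovariance

/-!
# The crux `CardyIKTransport.CornerLineDescent` (stmt-CriticalPhenomena-10964) is EXACTLY rate-free corner
# irrelevance in the gauge; the frozen end is an equivalence

Support file (`--supports stmt-CriticalPhenomena-10964`, line `symmetric-seed-second-order`, lead c3; registered
names `cornerLineDescent_of_cornerIrrelevance`, `cornerLineDescent_iff_cornerIrrelevance_of_cardyIK`,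
`crudeBondCardy_iff_gaugeZeroCardy`, `cornerIrrelevance_of_influenceBounds`, `cornerIrrelevance_of_windows`).  Vocabulary of
`Theorems/CardyIKTransportCornerLineDescentLine.lean`: `gaugeCrossingProb p R δ` is the crude crossing probability of the
conformal rectangle `R` at mesh `δ` for the crux's own i.i.d.-bit gauge with plaquette-defect density `p`
(`p = pIK = 2√3 − 3` is the crux's `P_IK`, `p = 0` is bond-`ℤ²` at `½` on the renewal grid), `bondStdCrossingProb R δ`
the crux's consequent family (standard bond-`ℤ²` at `½`).  Write

  `CornerIrrelevance R :≡ gaugeCrossingProb pIK R δ − gaugeCrossingProb 0 R δ → 0` as `δ → 0⁺`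

(stated inline below, never as a definition: it is a statement the route would have to POSIT, not a literature fact).

What is proved here (logic over landed theorems; no new estimate):

* §1 THE FROZEN END IS AN EQUIVALENCE.  The finite-mesh comparison `Freeze.FreezeComparisonAt R`
  (`gaugeCrossingProb 0 (e^{iπ/4} R) δ − bondStdCrossingProb R (2δ) → 0`) holds for EVERY conformal rectangle with no
  hypothesis (`freezeComparisonAt`: renewal coupling + SLLN + sandwich `Freeze.freezeComparisonAt_of_continuity`
  (p93823), crude continuity from Schramm–Smirnov 2011 Lemma 5.1 `stub_CrudeCrossingContinuity_of_SS` (p95499), and the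
  discharged fact `QuadCrossing.SchrammSmirnov2011_lemma_5_1_holds` (p99052)).  Being two-sided, it transfers crossing
  limits BOTH ways (`tendsto_gaugeZero_rot_of_bondStd`, and un-rotating with `map_mulLeft₀_inv_map_mulLeft₀`):
  `crudeBondCardy_iff_gaugeZeroCardy` — for every limit shape `F`, "`F`-limits for crude standard bond-`ℤ²` in every
  conformal rectangle" ↔ "`F`-limits for the frozen gauge in every conformal rectangle".  (The landed
  `stub_FreezeToStandard`, p100600, is the `←` direction at `F = cardyFunction`.)
* §2 THE CRUX ⟸ RATE-FREE CORNER IRRELEVANCE (`cornerLineDescent_of_cornerIrrelevance`): limits transfer along the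
  vanishing difference, then §1.  And CONVERSELY UNDER THE ROUTE'S HYPOTHESIS (a) = `CardyDiluteOrbit.CardyIK`
  (stmt-5913, character-for-character the antecedent of the crux): `cornerLineDescent_iff_cornerIrrelevance_of_cardyIK`.
  So, granted `CardyIK`, the crux, the sibling crux `IKBondBridge` (stmt-5914, `…OfIKBondBridge.lean` p107327) and
  `∀ R, CornerIrrelevance R` are three spellings of ONE statement: every line of this crux must prove rate-free corner
  irrelevance along `t ∈ [0, √3/2]`, and nothing more is needed.
* §3 TWO SUFFICIENT WINDOW DECOMPOSITIONS, both landing on `∀ R, CornerIrrelevance R`: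
  (i) `cornerIrrelevance_of_influenceBounds` — the line's two registered power-rate stubs (`InfluenceBoundOn`,
  `DiluteBoundOn`; composition p106570 factored through the difference), and
  (ii) `cornerIrrelevance_of_windows` / `cornerLineDescent_of_windows` — the RATE-FREE pair "Regime One" (below the
  window `p ≤ Kδ` the dislocation gas moves nothing, every `K`) + "large-scale irrelevance" (for every `ε` some window
  constant `K` with `|P_IK − P_{Kδ}| ≤ ε` eventually), which is the endgame of the sibling line `dislocation-gas-endgame`
  (`Cruxes/CornerLineDescent/Lines/dislocation-gas-endgame.lean`: `RegimeOne`, `LargeScaleIrrelevance`) written in this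
  vocabulary; (ii) is implied by (i) (`uci_of`, `regimeOne_of`, p106570) and is the weakest typed form in the tree of what
  remains open.

Purpose: the planner's promote / conditional-bridge step can now file ONE rate-free statement per rectangle (or the
rate-free pair of §3(ii)) instead of the two power-rate influence stubs, with the equivalence §2 certifying that nothing
weaker can close the crux under (a).
References: route file `Theses/CardyIKTransport.lean` (item 10964); `Theses/CardyDiluteOrbit.lean` (items 5913, 5914);
`Cruxes/CornerLineDescent/Disproof.lean` §A; Schramm–Smirnov, Ann. Probab. 39 (2011) §5.
-/

noncomputable section

namespace Summit.CriticalPhenomena.CardyFormulaZ2.Theorems.CornerLineDescent.SymmetricSeed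

open scoped Topology
open Filter Set
open Literature.Probability.RandomPlanarGeometry

/-! ## §1 The frozen end is an equivalence -/

/-- THE FINITE-MESH FREEZE COMPARISON, UNCONDITIONALLY, for every conformal rectangle:
`gaugeCrossingProb 0 (e^{iπ/4} R) δ − bondStdCrossingProb R (2δ) → 0` as `δ → 0⁺`
(`Freeze.freezeComparisonAt_of_continuity` ∘ `stub_CrudeCrossingContinuity_of_SS` ∘
`QuadCrossing.SchrammSmirnov2011_lemma_5_1_holds`). [folklore] -/
theorem freezeComparisonAt (R : ConformalRectangle) : Freeze.FreezeComparisonAt R :=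
  Freeze.freezeComparisonAt_of_continuity R
    (stub_CrudeCrossingContinuity_of_SS
      Literature.Probability.Percolation.QuadCrossing.SchrammSmirnov2011_lemma_5_1_holds R)

/-- STANDARD ⇒ FROZEN at the rotated rectangle (the direction NOT used by `stub_FreezeToStandard`): if the standard
bond-`ℤ²` crude crossing probabilities of `R` converge to `L`, so do the frozen-gauge ones of `e^{iπ/4} R` (the mesh
factor `2` is invisible along `𝓝[>] 0`). [folklore] -/
theorem tendsto_gaugeZero_rot_of_bondStd (R : ConformalRectangle) {L : ℝ}
    (h : Tendsto (bondStdCrossingProb R) (𝓝[>] 0) (𝓝 L)) :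
    Tendsto (gaugeCrossingProb 0
        (R.map (Homeomorph.mulLeft₀ (Complex.exp (((Real.pi / 4 : ℝ) : ℂ) * Complex.I)) (Complex.exp_ne_zero _))))
      (𝓝[>] 0) (𝓝 L) := by
  have h2 : Tendsto (fun δ => bondStdCrossingProb R (2 * δ)) (𝓝[>] 0) (𝓝 L) :=
    (Freeze.tendsto_comp_const_mul_nhdsGT_zero_iff (bondStdCrossingProb R) two_pos _).2 h
  have h3 := (freezeComparisonAt R).add h2
  simp only [zero_add, sub_add_cancel] at h3
  exact h3

/-- Un-rotating: `c · (c⁻¹ · R) = R` as conformal rectangles (same carrier, same boundary loop, same marks;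
`MarkedDomain.map_map` and the extensionality of `LatticeSimilarityCovariance`). [folklore] -/
theorem map_mulLeft₀_inv_map_mulLeft₀ (R : ConformalRectangle) {c : ℂ} (hc : c ≠ 0) :
    (R.map (Homeomorph.mulLeft₀ c⁻¹ (inv_ne_zero hc))).map (Homeomorph.mulLeft₀ c hc) = R := by
  have hid : ∀ z : ℂ,
      ((Homeomorph.mulLeft₀ c⁻¹ (inv_ne_zero hc)).trans (Homeomorph.mulLeft₀ c hc)) z = z := by
    intro z
    change c * (c⁻¹ * z) = z
    rw [← mul_assoc, mul_inv_cancel₀ hc, one_mul]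
  rw [MarkedDomain.map_map]
  refine MarkedDomain.ext (JordanDomain.ext ?_ ?_) rfl
  · show ((Homeomorph.mulLeft₀ c⁻¹ (inv_ne_zero hc)).trans (Homeomorph.mulLeft₀ c hc)) '' R.carrier = R.carrier
    conv_rhs => rw [← Set.image_id R.carrier]
    exact Set.image_congr fun z _ => hid z
  · show ((Homeomorph.mulLeft₀ c⁻¹ (inv_ne_zero hc)).trans (Homeomorph.mulLeft₀ c hc)) ∘ R.boundary = R.boundary
    funext t
    exact hid _

/-- THE FROZEN END IS AN EQUIVALENCE: for every limit shape `F`, `F`-limits of the crude STANDARD bond-`ℤ²` crossing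
probabilities in every conformal rectangle ↔ `F`-limits of the FROZEN-GAUGE (`p = 0`, renewal grid) crossing
probabilities in every conformal rectangle.  `→`: transport a datum of `R` to `e^{-iπ/4} R` (same real preimages,
`Freeze.exists_isUniformizing_map_mulLeft₀`), apply the hypothesis there, pull back through
`tendsto_gaugeZero_rot_of_bondStd` and un-rotate (`map_mulLeft₀_inv_map_mulLeft₀`); `←`: the landed direction
(`Freeze.freezeHomogenisationAt_of_comparisonAt` ∘ `freezeComparisonAt`, as in `stub_FreezeToStandard`). [folklore] -/
theorem crudeBondCardy_iff_gaugeZeroCardy :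
    ∀ F : ℝ → ℝ, (∀ R : ConformalRectangle, R.HasCrossingLimit (bondStdCrossingProb R) F) ↔
      ∀ R : ConformalRectangle, R.HasCrossingLimit (gaugeCrossingProb 0 R) F := by
  intro F
  set c : ℂ := Complex.exp (((Real.pi / 4 : ℝ) : ℂ) * Complex.I) with hcdef
  have hc : c ≠ 0 := Complex.exp_ne_zero _
  constructor
  · intro h R φ x hφx
    obtain ⟨ψ, hψ⟩ := Freeze.exists_isUniformizing_map_mulLeft₀ R (inv_ne_zero hc) hφx
    have h1 := h _ ψ x hψ
    have h2 := tendsto_gaugeZero_rot_of_bondStd _ h1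
    rwa [map_mulLeft₀_inv_map_mulLeft₀ R hc] at h2
  · intro h R φ x hφx
    obtain ⟨ψ, hψ⟩ := Freeze.exists_isUniformizing_map_mulLeft₀ R hc hφx
    exact Freeze.freezeHomogenisationAt_of_comparisonAt (freezeComparisonAt R) _ (h _ ψ x hψ)

/-! ## §2 The crux is rate-free corner irrelevance -/

/-- THE CRUX ⟸ RATE-FREE CORNER IRRELEVANCE: if for every conformal rectangle the isotropic-IK gauge and the frozen
gauge have crude crossing probabilities differing by `o(1)` as `δ → 0⁺`, then `CornerLineDescent` holds — Cardy for
`P_IK` transfers along the vanishing difference to the frozen gauge, and the frozen end (`stub_FreezeToStandard`,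
unconditional) carries it to standard bond-`ℤ²`. [folklore] -/
theorem cornerLineDescent_of_cornerIrrelevance :
    (∀ R : ConformalRectangle,
      Tendsto (fun δ => gaugeCrossingProb pIK R δ - gaugeCrossingProb 0 R δ) (𝓝[>] 0) (𝓝 0)) →
    Summit.CriticalPhenomena.CardyFormulaZ2.Theses.CardyIKTransport.CornerLineDescent := by
  intro h
  rw [cornerLineDescent_iff]
  intro hIK
  apply stub_FreezeToStandard
  intro R φ x hφx
  have h3 := (hIK R φ x hφx).sub (h R)
  simp only [sub_sub_cancel, sub_zero] at h3
  exact h3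

/-- Cardy for `P_IK` and Cardy for crude standard bond-`ℤ²` (both in every conformal rectangle) give rate-free corner
irrelevance: both gauge families then converge to the Cardy value of the modulus (the frozen one through
`crudeBondCardy_iff_gaugeZeroCardy`; a uniformizing datum exists by `MarkedDomain.exists_isUniformizing_holds`). [folklore] -/
theorem cornerIrrelevance_of_cardyIK_of_crudeBondCardy
    (hIK : ∀ R : ConformalRectangle, R.HasCrossingLimit (gaugeCrossingProb pIK R) cardyFunction)
    (hB : ∀ R : ConformalRectangle, R.HasCrossingLimit (bondStdCrossingProb R) cardyFunction) :
    ∀ R : ConformalRectangle,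
      Tendsto (fun δ => gaugeCrossingProb pIK R δ - gaugeCrossingProb 0 R δ) (𝓝[>] 0) (𝓝 0) := by
  intro R
  obtain ⟨φ, x, hφx⟩ := MarkedDomain.exists_isUniformizing_holds R
  have h0 := (crudeBondCardy_iff_gaugeZeroCardy cardyFunction).1 hB R φ x hφx
  have h3 := (hIK R φ x hφx).sub h0
  simp only [sub_self] at h3
  exact h3

/-- UNDER THE ROUTE'S HYPOTHESIS (a) THE CRUX *IS* RATE-FREE CORNER IRRELEVANCE: granted `CardyDiluteOrbit.CardyIK`
(stmt-CriticalPhenomena-5913 — character-for-character the antecedent of `CornerLineDescent`), the crux holds iff for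
every conformal rectangle `gaugeCrossingProb pIK R δ − gaugeCrossingProb 0 R δ → 0`.  With
`cornerLineDescent_iff_ikBondBridge_of_cardyIK` (p107327): crux ⟺ `IKBondBridge` (stmt-5914) ⟺ corner irrelevance,
under (a). [folklore] -/
theorem cornerLineDescent_iff_cornerIrrelevance_of_cardyIK :
    Summit.CriticalPhenomena.CardyFormulaZ2.Theses.CardyDiluteOrbit.CardyIK →
    (Summit.CriticalPhenomena.CardyFormulaZ2.Theses.CardyIKTransport.CornerLineDescent ↔
      ∀ R : ConformalRectangle,
        Tendsto (fun δ => gaugeCrossingProb pIK R δ - gaugeCrossingProb 0 R δ) (𝓝[>] 0) (𝓝 0)) :=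
  fun hIK => ⟨fun h => cornerIrrelevance_of_cardyIK_of_crudeBondCardy hIK (h hIK), cornerLineDescent_of_cornerIrrelevance⟩

/-! ## §3 Two sufficient window decompositions -/

/-- (i) THE LINE'S TWO POWER-RATE STUBS ⟹ RATE-FREE CORNER IRRELEVANCE (the landed composition p106570, factored
through the difference): Russo (`stub_Russo stub_Locality`) turns the summed and dilute influence bounds into uniform
corner irrelevance in units of `ξ_p` (`uci_of`) and Regime One (`regimeOne_of`), which overlap (`endgame_core`). [folklore] -/
theorem cornerIrrelevance_of_influenceBounds :
    (∀ R : ConformalRectangle, ∃ θ C c₀ : ℝ, 0 < θ ∧ 0 < c₀ ∧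
      ∀ᶠ δ in 𝓝[>] (0:ℝ), InfluenceBoundOn R θ C c₀ δ) →
    (∀ (R : ConformalRectangle) (c : ℝ), 0 < c → ∃ C κ : ℝ, 0 < κ ∧
      ∀ᶠ δ in 𝓝[>] (0:ℝ), DiluteBoundOn R c C κ δ) →
    ∀ R : ConformalRectangle,
      Tendsto (fun δ => gaugeCrossingProb pIK R δ - gaugeCrossingProb 0 R δ) (𝓝[>] 0) (𝓝 0) := by
  intro hsum hdil R
  have hrusso := stub_Russo stub_Locality
  have hUCI := uci_of hrusso hsum
  have hR1 := regimeOne_of hrusso hdil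
  rw [Metric.tendsto_nhds]
  intro ε hε
  filter_upwards [endgame_core hR1 hUCI R (ε / 2) (half_pos hε)] with δ hδ
  rw [Real.dist_eq, sub_zero]
  exact lt_of_le_of_lt hδ (half_lt_self hε)

/-- (ii) THE RATE-FREE WINDOW PAIR ⟹ RATE-FREE CORNER IRRELEVANCE: "Regime One" (below every window `p ≤ K δ` the
dislocation gas does not move crude crossing probabilities) and "large-scale irrelevance" (for every `ε` some window
constant `K` with `|P_IK − P_{Kδ}| ≤ ε` eventually) overlap at `p = K δ`.  These are `RegimeOne` and (the consequent
of) `LargeScaleIrrelevance` of the sibling line `dislocation-gas-endgame`, in this vocabulary. [folklore] -/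
theorem cornerIrrelevance_of_windows :
    (∀ (R : ConformalRectangle) (ε : ℝ), 0 < ε → ∀ K : ℝ, 0 < K →
      ∀ᶠ δ in 𝓝[>] (0:ℝ), ∀ p : ℝ, 0 ≤ p → p ≤ K * δ →
        |gaugeCrossingProb p R δ - gaugeCrossingProb 0 R δ| ≤ ε) →
    (∀ (R : ConformalRectangle) (ε : ℝ), 0 < ε → ∃ K : ℝ, 0 < K ∧
      ∀ᶠ δ in 𝓝[>] (0:ℝ), |gaugeCrossingProb pIK R δ - gaugeCrossingProb (K * δ) R δ| ≤ ε) →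
    ∀ R : ConformalRectangle,
      Tendsto (fun δ => gaugeCrossingProb pIK R δ - gaugeCrossingProb 0 R δ) (𝓝[>] 0) (𝓝 0) := by
  intro h1 h2 R
  rw [Metric.tendsto_nhds]
  intro ε hε
  obtain ⟨K, hK, hev2⟩ := h2 R (ε / 3) (by positivity)
  have hev1 := h1 R (ε / 3) (by positivity) K hK
  have hpos : ∀ᶠ δ in 𝓝[>] (0:ℝ), δ ∈ Set.Ioi (0:ℝ) := eventually_mem_nhdsWithin
  filter_upwards [hev1, hev2, hpos] with δ hδ1 hδ2 hδpos
  have hδpos : 0 < δ := hδpos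
  have hA := hδ1 (K * δ) (by positivity) le_rfl
  rw [Real.dist_eq, sub_zero]
  calc |gaugeCrossingProb pIK R δ - gaugeCrossingProb 0 R δ|
      ≤ |gaugeCrossingProb pIK R δ - gaugeCrossingProb (K * δ) R δ| +
          |gaugeCrossingProb (K * δ) R δ - gaugeCrossingProb 0 R δ| := abs_sub_le _ _ _
    _ ≤ ε / 3 + ε / 3 := add_le_add hδ2 hA
    _ < ε := by linarith

/-- THE CRUX MODULO THE RATE-FREE WINDOW PAIR (large-scale irrelevance allowed to use Cardy for `P_IK`, as
`LargeScaleIrrelevance` of line `dislocation-gas-endgame` does): Regime One + large-scale irrelevance under `CardyIK`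
⟹ `CornerLineDescent`. [folklore] -/
theorem cornerLineDescent_of_windows
    (h1 : ∀ (R : ConformalRectangle) (ε : ℝ), 0 < ε → ∀ K : ℝ, 0 < K →
      ∀ᶠ δ in 𝓝[>] (0:ℝ), ∀ p : ℝ, 0 ≤ p → p ≤ K * δ →
        |gaugeCrossingProb p R δ - gaugeCrossingProb 0 R δ| ≤ ε)
    (h2 : (∀ R : ConformalRectangle, R.HasCrossingLimit (gaugeCrossingProb pIK R) cardyFunction) →
      ∀ (R : ConformalRectangle) (ε : ℝ), 0 < ε → ∃ K : ℝ, 0 < K ∧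
        ∀ᶠ δ in 𝓝[>] (0:ℝ), |gaugeCrossingProb pIK R δ - gaugeCrossingProb (K * δ) R δ| ≤ ε) :
    Summit.CriticalPhenomena.CardyFormulaZ2.Theses.CardyIKTransport.CornerLineDescent := by
  rw [cornerLineDescent_iff]
  intro hIK
  exact (cornerLineDescent_iff.1 (cornerLineDescent_of_cornerIrrelevance (cornerIrrelevance_of_windows h1 (h2 hIK))))
    hIK

end Summit.CriticalPhenomena.CardyFormulaZ2.Theorems.CornerLineDescent.SymmetricSeed
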